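import Summits.Ventures.DiscreteObjects.UnitDistance.TwoPlaceZMod11Data
import HarnessLib

/-!
# `unitCircleGraph (ZMod 11 × ZMod 11)` is not 4-colourable — kernel search, piece 1 of 2 (sub-searches below `t121Q1, t121Q2, t121Q4, t121Q7`)

Framing (verbatim for the cell): lottery ticket; floor = certified bounds/negative ranges.

Each state `t121Qi` of `TwoPlaceZMod11Data.lean` is refuted by the bit-vector colouring search of `KernelColouringSearch.lean`
(`decide +kernel`, one evaluation per state: 463, 48, 61, 257 branch nodes), and `t121_pieceI` packages the logical
statement used by `TwoPlaceZMod11.lean`: no proper 4-colouring is consistent with `t121Qi`.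
-/

namespace Summit.Ventures.DiscreteObjects.UnitDistance

open KBits

set_option maxHeartbeats 400000000 in
set_option maxRecDepth 200000 in
/-- KERNEL FACT: the search refutes every 4-colouring below `t121Q1`. -/
theorem t121Q1_run : search t121nb 425 200 [] 425 t121Q1 = true := by
  decide +kernel

/-- PIECE: no proper 4-colouring (for the neighbourhood words `t121nb`) is consistent with the state `t121Q1`. -/
theorem t121_piece1 {col : ℕ → ℕ} (hP : Proper t121nb 425 col) :
    UBound 425 t121Q1 → Cons 425 col t121Q1 → False :=
  search_sound hP (done := []) (by simp) 425 _ t121Q1_run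

set_option maxHeartbeats 400000000 in
set_option maxRecDepth 200000 in
/-- KERNEL FACT: the search refutes every 4-colouring below `t121Q2`. -/
theorem t121Q2_run : search t121nb 425 200 [] 425 t121Q2 = true := by
  decide +kernel

/-- PIECE: no proper 4-colouring (for the neighbourhood words `t121nb`) is consistent with the state `t121Q2`. -/
theorem t121_piece2 {col : ℕ → ℕ} (hP : Proper t121nb 425 col) :
    UBound 425 t121Q2 → Cons 425 col t121Q2 → False :=
  search_sound hP (done := []) (by simp) 425 _ t121Q2_run

set_option maxHeartbeats 400000000 in
set_option maxRecDepth 200000 in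
/-- KERNEL FACT: the search refutes every 4-colouring below `t121Q4`. -/
theorem t121Q4_run : search t121nb 425 200 [] 425 t121Q4 = true := by
  decide +kernel

/-- PIECE: no proper 4-colouring (for the neighbourhood words `t121nb`) is consistent with the state `t121Q4`. -/
theorem t121_piece4 {col : ℕ → ℕ} (hP : Proper t121nb 425 col) :
    UBound 425 t121Q4 → Cons 425 col t121Q4 → False :=
  search_sound hP (done := []) (by simp) 425 _ t121Q4_run

set_option maxHeartbeats 400000000 in
set_option maxRecDepth 200000 in
/-- KERNEL FACT: the search refutes every 4-colouring below `t121Q7`. -/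
theorem t121Q7_run : search t121nb 425 200 [] 425 t121Q7 = true := by
  decide +kernel

/-- PIECE: no proper 4-colouring (for the neighbourhood words `t121nb`) is consistent with the state `t121Q7`. -/
theorem t121_piece7 {col : ℕ → ℕ} (hP : Proper t121nb 425 col) :
    UBound 425 t121Q7 → Cons 425 col t121Q7 → False :=
  search_sound hP (done := []) (by simp) 425 _ t121Q7_run

end Summit.Ventures.DiscreteObjects.UnitDistance
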